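import Summits.CriticalPhenomena.PercolationContinuityZ3.Theorems.PercNearOneGluingAdditiveGluingClusterPeel
import Summits.CriticalPhenomena.PercolationContinuityZ3.Theorems.PercNearOneGluingAdditiveGluingAGlocCardLeTwo
import Summits.CriticalPhenomena.PercolationContinuityZ3.Theorems.PercNearOneGluingAdditiveGluingOfAGloc
import HarnessLib

/-! # Crux `PercNearOneGluing.AdditiveGluing` (stmt-CriticalPhenomena-4576) — the localised union bound (AG-loc) BY PEELING:
# `AG-loc ⟸ (LOC-peel)`, an inductive kernel whose residual bound is AG-loc itself

Support file (`--supports stmt-CriticalPhenomena-4576`, cell `prim-png-dp-al5` gen 5).  No definitions, no named facts, no sorries; the kernel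
(LOC-peel) is a HYPOTHESIS (spelled out) of the final theorems.

(AG-loc) (lead-of-record prim-png-lead-4576 gen 6, first-in-rank form of `…AdditiveGluingOfAGloc.lean`): for a rank `r` injective on `A` with less
reliable relays first and `P_a := {o ↔ a} ∩ ⋂_{r a' < r a} {o ↮ a'}`,  `μ(o ↔ A, o ↮ b) ≤ Λ(A) := Σ_{a ∈ A} μ(P_a)·μ(a ↮ b)`  (= `E[max_{a ∈ C(o)∩A} μ(a↮b)]`).
It implies KN Conjecture 1 and the crux; `|A| ≤ 2` is the tree's `AGloc.agloc_firstRank_card_le_two`.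

(LOC-peel) — one-relay cluster peeling (`ClusterPeel.peel_bound`) with the residual failure of `G − W` bounded by AG-loc OF THE RESIDUAL INSTANCE
(`Λ_W(A∖W)`, residual reliabilities `μ_{G−W}(a ↔ b)` and a residual-compatible rank `r_W`):
  `∃ d ∈ A, ∃ (r_W)_W:   μ(o ↔ d, d ↮ b) + μ(d ↔ b, d ↮ o, o ↔ A∖d) + Σ_{W ∌ o,b} μ(C(d) = W)·Λ_W(A∖W)  ≤  Λ(A)`.
Equivalently (integrating out the cluster law): `Cov(1{o↔d}, 1{d↔b}) + E[τ_d − min_{C(o)∩A} τ ; d ∈ C(o)] ≥ E[min_{C(o)∩A} τ ; d ↔ b, d ∉ C(o) ∋ some a]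
+ E_{W = C(d) ∌ o,b} E_{G−W}[min_S τ − min_S τ^{G−W}; S ≠ ∅]` ("the Harris surplus at `d` pays for `d` swallowing `b` away from an attached observer and for
the reliability the survivors lose with `C(d)`").  For `|A| = 1` it is Harris; for `|A| = 3` it is a single 5-point inequality whose truth gives AG-loc(3)
(hence `AdditiveGluing` for three relays) outright, since its residual instances have `≤ 2` relays.
Evidence (this seat, exact rationals, lab/mu3.py; kit j075750/j075839): `d` = the most-attached relay satisfies (LOC-peel) on all 29 exact (MU)/(MU-A) witnesses
of ttrl2 (`run/shared/lean/ttrl/mu/violations_MU.jsonl`; L/λ ≥ 0.85, on the (MU-A) killer 0.977 where (MU-opt) keeps 0.16) and on 8 300 random instances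
(n ≤ 7, |A| = 2…5); adversarial climbs pending at the time of landing.  This file only proves the REDUCTION.
* `ClusterPeelLoc.agloc_firstRank_of_locPeel` — (LOC-peel) ⇒ (AG-loc) for every relay set (strong induction on `|A|`; `o = b`, `o ∈ A`, `b ∈ A` are
  handled without the kernel; residual instances = `restrW Wᶜ w`).
* `ClusterPeelLoc.additiveGluing_of_locPeel` — (LOC-peel) ⇒ `AdditiveGluing` (via the landed `AGloc.additiveGluing_of_agloc_firstRank`).
[cite: KozmaNitzan2024, Conj. 1 (p. 3), §3.2 p. 12 (conditioning on C(0) = W), Thm. 1 pp. 7–8]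
-/

namespace Summit.CriticalPhenomena.PercolationContinuityZ3.Theorems

open MeasureTheory Set
open Literature.Probability.LatticeModels (prodBernoulli)
open Literature.Probability.Percolation
open scoped BigOperators

noncomputable section
open Classical

namespace ClusterPeelLoc

open ClusterPeel

variable {V : Type*} [Fintype V] [DecidableEq V]

/-- `Σ_{W ∌ o, b} μ(C(d) = W) = μ(d ↮ o, d ↮ b)`. [folklore] -/
theorem sum_clusterIs_filter_eq (w : Sym2 V → unitInterval) (o b d : V) :
    ∑ W ∈ Finset.univ.filter (fun W : Finset V => o ∉ W ∧ b ∉ W), (prodBernoulli w).real (clusterIs d W) =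
      (prodBernoulli w).real ((openConn d o)ᶜ ∩ (openConn d b)ᶜ : Set (BondConfig V)) := by
  rw [real_eq_sum_clusterIs_inter w d, Finset.sum_filter]
  refine Finset.sum_congr rfl fun W _ => ?_
  split_ifs with h
  · congr 1
    ext ω
    exact ⟨fun hω => ⟨hω, fun hdo => h.1 ((reach_iff_mem hω o).1 hdo), fun hdb => h.2 ((reach_iff_mem hω b).1 hdb)⟩, fun hω => hω.1⟩
  · have : clusterIs d W ∩ ((openConn d o)ᶜ ∩ (openConn d b)ᶜ : Set (BondConfig V)) = ∅ := by
      ext ω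
      simp only [mem_inter_iff, mem_compl_iff, mem_empty_iff_false, iff_false, not_and, not_not]
      intro hω hdo
      by_contra hdb
      exact h ⟨fun ho => hdo ((reach_iff_mem hω o).2 ho), fun hb => hdb ((reach_iff_mem hω b).2 hb)⟩
    rw [this, measureReal_empty]

omit [DecidableEq V] in
/-- `μ_{G−W}` of a first-in-rank pattern event = `μ` of the same event written with paths avoiding `W` (`o ∉ W`).
[cite: KozmaNitzan2024, §3.2 p. 12 (the graphs G ∖ W)] -/
theorem restr_real_firstPat (w : Sym2 V → unitInterval) (W F : Finset V) {o : V} (ho : o ∉ W) (a : V) :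
    (prodBernoulli (restrW ((↑W : Set V)ᶜ) w)).real (openConn o a ∩ ⋂ a' ∈ F, (openConn o a')ᶜ : Set (BondConfig V)) =
      (prodBernoulli w).real (openConnIn ((↑W : Set V)ᶜ) o a ∩ ⋂ a' ∈ F, (openConnIn ((↑W : Set V)ᶜ) o a')ᶜ) := by
  rw [KNGoodAux.restrW_real_eq]
  congr 1
  have ho' : o ∈ ((↑W : Set V)ᶜ) := fun h => ho (Finset.mem_coe.1 h)
  ext ω
  simp only [mem_setOf_eq, mem_inter_iff, mem_iInter, mem_compl_iff]
  rw [KNGoodAux.inter_wireSet_mem_openConn_iff ho' a]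
  refine and_congr_right fun _ => forall₂_congr fun a' _ => ?_
  rw [KNGoodAux.inter_wireSet_mem_openConn_iff ho' a']

/-! ### (LOC-peel) ⇒ (AG-loc), by strong induction on `|A|` -/

/-- **(LOC-peel) ⇒ (AG-loc) (first-in-rank form) for every finite weighted graph on `Fin n`, every relay set, every compatible injective rank.**
Strong induction on `|A|`: `|A| ≤ 2` is `AGloc.agloc_firstRank_card_le_two`; `o = b` is empty; `o ∈ A`: every pattern's first relay is at most as
reliable as `o`; `b ∈ A`: the instance equals the one on `A ∖ b` term by term; otherwise peel the relay `d` of the kernel (`ClusterPeel.peel_bound`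
with the induction hypothesis on the residual instance `restrW Wᶜ w`, rank `r_W`). [cite: KozmaNitzan2024, Conj. 1 (p. 3), §3.2 p. 12] -/
theorem agloc_firstRank_of_locPeel
    (hL : ∀ (n : ℕ) (w : Sym2 (Fin n) → unitInterval) (A : Finset (Fin n)) (o b : Fin n) (r : Fin n → ℕ),
      o ∉ A → b ∉ A → o ≠ b → 3 ≤ A.card → Set.InjOn r ↑A →
      (∀ a ∈ A, ∀ a' ∈ A, r a < r a' → (prodBernoulli w).real (openConn a b) ≤ (prodBernoulli w).real (openConn a' b)) →
      ∃ d ∈ A, ∃ rW : Finset (Fin n) → (Fin n → ℕ),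
        (∀ W : Finset (Fin n), Set.InjOn (rW W) ↑(A \ W)) ∧
        (∀ W : Finset (Fin n), ∀ a ∈ A \ W, ∀ a' ∈ A \ W, rW W a < rW W a' →
          (prodBernoulli w).real (openConnIn ((↑W : Set (Fin n))ᶜ) a b) ≤ (prodBernoulli w).real (openConnIn ((↑W : Set (Fin n))ᶜ) a' b)) ∧
        (prodBernoulli w).real (openConn d o ∩ (openConn d b)ᶜ : Set (BondConfig (Fin n)))
          + (prodBernoulli w).real (openConn d b ∩ (openConn d o)ᶜ ∩ (⋃ a ∈ A.erase d, openConn o a))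
          + ∑ W ∈ Finset.univ.filter (fun W : Finset (Fin n) => o ∉ W ∧ b ∉ W),
              (prodBernoulli w).real (clusterIs d W) *
                ∑ a ∈ A \ W, (prodBernoulli w).real
                    (openConnIn ((↑W : Set (Fin n))ᶜ) o a ∩
                      ⋂ a' ∈ (A \ W).filter (fun a' => rW W a' < rW W a), (openConnIn ((↑W : Set (Fin n))ᶜ) o a')ᶜ) *
                  (1 - (prodBernoulli w).real (openConnIn ((↑W : Set (Fin n))ᶜ) a b))
        ≤ ∑ a ∈ A, (prodBernoulli w).real
              (openConn o a ∩ ⋂ a' ∈ A.filter (fun a' => r a' < r a), (openConn o a')ᶜ : Set (BondConfig (Fin n))) *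
            (1 - (prodBernoulli w).real (openConn a b)))
    (n : ℕ) :
    ∀ (K : ℕ) (w : Sym2 (Fin n) → unitInterval) (A : Finset (Fin n)) (o b : Fin n) (r : Fin n → ℕ),
      A.card ≤ K → Set.InjOn r ↑A →
      (∀ a ∈ A, ∀ a' ∈ A, r a < r a' → (prodBernoulli w).real (openConn a b) ≤ (prodBernoulli w).real (openConn a' b)) →
      (prodBernoulli w).real ((⋃ a ∈ A, openConn o a) ∩ (openConn o b)ᶜ : Set (BondConfig (Fin n))) ≤
        ∑ a ∈ A, (prodBernoulli w).real
            (openConn o a ∩ ⋂ a' ∈ A.filter (fun a' => r a' < r a), (openConn o a')ᶜ : Set (BondConfig (Fin n))) *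
          (1 - (prodBernoulli w).real (openConn a b)) := by
  intro K
  induction K with
  | zero =>
    intro w A o b r hA hr hc
    exact AGloc.agloc_firstRank_card_le_two w A o b r (by omega) hr hc
  | succ K ih =>
    intro w A o b r hA hr hc
    set μ := prodBernoulli w with hμ
    have hmeas : ∀ E : Set (BondConfig (Fin n)), MeasurableSet E := fun E => MeasurableSet.of_discrete
    -- abbreviation for the patterns
    set P : Fin n → Set (BondConfig (Fin n)) := fun a =>
      (openConn o a ∩ ⋂ a' ∈ A.filter (fun a' => r a' < r a), (openConn o a')ᶜ : Set (BondConfig (Fin n))) with hP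
    have hRHS_nonneg : ∀ a ∈ A, 0 ≤ μ.real (P a) * (1 - μ.real (openConn a b)) := fun a _ =>
      mul_nonneg measureReal_nonneg (by linarith [measureReal_le_one (μ := μ) (s := (openConn a b : Set (BondConfig (Fin n))))])
    by_cases hA2 : A.card ≤ 2
    · exact AGloc.agloc_firstRank_card_le_two w A o b r hA2 hr hc
    by_cases hob : o = b
    · subst hob
      have : ((⋃ a ∈ A, openConn o a) ∩ (openConn o o)ᶜ : Set (BondConfig (Fin n))) = ∅ := by
        ext ω
        simp only [mem_inter_iff, mem_compl_iff, mem_empty_iff_false, iff_false, not_and, not_not]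
        exact fun _ => SimpleGraph.Reachable.refl o
      rw [this, measureReal_empty]
      exact Finset.sum_nonneg hRHS_nonneg
    by_cases ho : o ∈ A
    · -- failure ⊆ {o ↮ b}; every pattern's first relay `a` has `r a ≤ r o`, hence `τ_a ≤ τ_o`, or the pattern is empty
      have hfail : μ.real ((⋃ a ∈ A, openConn o a) ∩ (openConn o b)ᶜ : Set (BondConfig (Fin n))) ≤ 1 - μ.real (openConn o b) := by
        calc μ.real ((⋃ a ∈ A, openConn o a) ∩ (openConn o b)ᶜ : Set (BondConfig (Fin n)))
            ≤ μ.real ((openConn o b)ᶜ : Set (BondConfig (Fin n))) := measureReal_mono inter_subset_right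
          _ = 1 - μ.real (openConn o b) := probReal_compl_eq_one_sub (hmeas _)
      have hterm : ∀ a ∈ A, μ.real (P a) * (1 - μ.real (openConn o b)) ≤ μ.real (P a) * (1 - μ.real (openConn a b)) := by
        intro a ha
        by_cases hlt : r o < r a
        · have hPa : P a = ∅ := by
            ext ω
            simp only [hP, mem_inter_iff, mem_iInter, mem_compl_iff, mem_empty_iff_false, iff_false, not_and, not_forall,
              not_not]
            intro _
            exact ⟨o, Finset.mem_filter.2 ⟨ho, hlt⟩, SimpleGraph.Reachable.refl o⟩
          rw [hPa, measureReal_empty, zero_mul, zero_mul]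
        · have hτ : μ.real (openConn a b) ≤ μ.real (openConn o b) := by
            by_cases hao : a = o
            · rw [hao]
            · exact hc a ha o ho (lt_of_le_of_ne (not_lt.1 hlt) fun h => hao (hr ha ho h))
          exact mul_le_mul_of_nonneg_left (by linarith) measureReal_nonneg
      have hsum : ∑ a ∈ A, μ.real (P a) = 1 := by
        rw [hP, AGloc.sum_measureReal_firstRank w A r o hr]
        apply le_antisymm measureReal_le_one
        have hsub : (openConn o o : Set (BondConfig (Fin n))) ⊆ ⋃ a ∈ A, openConn o a := fun ω hω => mem_biUnion ho hω
        calc (1 : ℝ) = μ.real (openConn o o : Set (BondConfig (Fin n))) := by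
              rw [show (openConn o o : Set (BondConfig (Fin n))) = univ from
                eq_univ_of_forall fun ω => SimpleGraph.Reachable.refl o, probReal_univ]
          _ ≤ μ.real (⋃ a ∈ A, openConn o a) := measureReal_mono hsub (measure_ne_top _ _)
      calc μ.real ((⋃ a ∈ A, openConn o a) ∩ (openConn o b)ᶜ : Set (BondConfig (Fin n)))
          ≤ (∑ a ∈ A, μ.real (P a)) * (1 - μ.real (openConn o b)) := by rw [hsum, one_mul]; exact hfail
        _ = ∑ a ∈ A, μ.real (P a) * (1 - μ.real (openConn o b)) := Finset.sum_mul _ _ _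
        _ ≤ ∑ a ∈ A, μ.real (P a) * (1 - μ.real (openConn a b)) := Finset.sum_le_sum hterm
    by_cases hb : b ∈ A
    · -- reduce to A.erase b: the failure event and every term are the same
      set A' := A.erase b with hA'
      have hcard : A'.card ≤ K := by rw [hA', Finset.card_erase_of_mem hb]; omega
      have hr' : Set.InjOn r ↑A' := hr.mono (by rw [hA']; exact Finset.coe_subset.2 (Finset.erase_subset b A))
      have hc' : ∀ a ∈ A', ∀ a' ∈ A', r a < r a' → μ.real (openConn a b) ≤ μ.real (openConn a' b) :=
        fun a ha a' ha' h => hc a (Finset.mem_of_mem_erase ha) a' (Finset.mem_of_mem_erase ha') h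
      have hIH := ih w A' o b r hcard hr' hc'
      have hfail : ((⋃ a ∈ A, openConn o a) ∩ (openConn o b)ᶜ : Set (BondConfig (Fin n))) =
          (⋃ a ∈ A', openConn o a) ∩ (openConn o b)ᶜ := by
        ext ω
        simp only [mem_inter_iff, mem_iUnion, mem_compl_iff, exists_prop]
        constructor
        · rintro ⟨⟨a, haA, hoa⟩, hnob⟩
          refine ⟨⟨a, Finset.mem_erase.2 ⟨?_, haA⟩, hoa⟩, hnob⟩
          rintro rfl; exact hnob hoa
        · rintro ⟨⟨a, haA, hoa⟩, hnob⟩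
          exact ⟨⟨a, Finset.mem_of_mem_erase haA, hoa⟩, hnob⟩
      have hτb : μ.real (openConn b b : Set (BondConfig (Fin n))) = 1 := by
        rw [show (openConn b b : Set (BondConfig (Fin n))) = univ from eq_univ_of_forall fun ω => SimpleGraph.Reachable.refl b,
          probReal_univ]
      -- termwise comparison
      have hterm : ∀ a ∈ A', μ.real (openConn o a ∩ ⋂ a' ∈ A'.filter (fun a' => r a' < r a), (openConn o a')ᶜ : Set (BondConfig (Fin n))) *
            (1 - μ.real (openConn a b)) = μ.real (P a) * (1 - μ.real (openConn a b)) := by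
        intro a ha
        have haA : a ∈ A := Finset.mem_of_mem_erase ha
        have hab : a ≠ b := Finset.ne_of_mem_erase ha
        by_cases hlt : r b < r a
        · -- then τ_b ≤ τ_a forces τ_a = 1
          have h1 : μ.real (openConn a b) = 1 :=
            le_antisymm measureReal_le_one (by have := hc b hb a haA hlt; rw [hτb] at this; exact this)
          rw [h1, sub_self, mul_zero, mul_zero]
        · congr 2
          rw [hP]
          congr 1
          have : A.filter (fun a' => r a' < r a) = A'.filter (fun a' => r a' < r a) := by
            ext x
            simp only [Finset.mem_filter, hA', Finset.mem_erase]
            constructor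
            · rintro ⟨hx, hlt'⟩
              refine ⟨⟨?_, hx⟩, hlt'⟩
              rintro rfl; exact hlt hlt'
            · rintro ⟨⟨_, hx⟩, hlt'⟩; exact ⟨hx, hlt'⟩
          rw [this]
      calc μ.real ((⋃ a ∈ A, openConn o a) ∩ (openConn o b)ᶜ : Set (BondConfig (Fin n)))
          = μ.real ((⋃ a ∈ A', openConn o a) ∩ (openConn o b)ᶜ : Set (BondConfig (Fin n))) := by rw [hfail]
        _ ≤ ∑ a ∈ A', μ.real (openConn o a ∩ ⋂ a' ∈ A'.filter (fun a' => r a' < r a), (openConn o a')ᶜ : Set (BondConfig (Fin n))) *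
              (1 - μ.real (openConn a b)) := hIH
        _ = ∑ a ∈ A', μ.real (P a) * (1 - μ.real (openConn a b)) := Finset.sum_congr rfl hterm
        _ ≤ ∑ a ∈ A, μ.real (P a) * (1 - μ.real (openConn a b)) := by
            rw [hA']
            exact Finset.sum_le_sum_of_subset_of_nonneg (Finset.erase_subset b A) fun a ha _ => hRHS_nonneg a ha
    -- main case: peel the relay of the kernel
    have hA3 : 3 ≤ A.card := by omega
    obtain ⟨d, hdA, rW, hrW, hcW, hker⟩ := hL n w A o b r ho hb hob hA3 hr hc
    set Wc : Finset (Fin n) → Set (Fin n) := fun W => ((↑W : Set (Fin n))ᶜ) with hWc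
    set β : Finset (Fin n) → ℝ := fun W =>
      ∑ a ∈ A \ W, μ.real (openConnIn (Wc W) o a ∩ ⋂ a' ∈ (A \ W).filter (fun a' => rW W a' < rW W a), (openConnIn (Wc W) o a')ᶜ) *
        (1 - μ.real (openConnIn (Wc W) a b)) with hβdef
    have hβ : ∀ W : Finset (Fin n), o ∉ W → b ∉ W → d ∈ W →
        μ.real ((⋃ a ∈ A \ W, openConnIn (Wc W) o a) ∩ (openConnIn (Wc W) o b)ᶜ) ≤ β W := by
      intro W hoW hbW hdW
      have hcard : (A \ W).card ≤ K := by
        have : (A \ W).card < A.card := Finset.card_lt_card ⟨Finset.sdiff_subset, fun h => (Finset.mem_sdiff.1 (h hdA)).2 hdW⟩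
        omega
      have hcomp : ∀ a ∈ A \ W, ∀ a' ∈ A \ W, rW W a < rW W a' →
          (prodBernoulli (restrW (Wc W) w)).real (openConn a b) ≤ (prodBernoulli (restrW (Wc W) w)).real (openConn a' b) := by
        intro a ha a' ha' h
        rw [hWc, restr_real_openConn w W (Finset.mem_sdiff.1 ha).2 b, restr_real_openConn w W (Finset.mem_sdiff.1 ha').2 b]
        exact hcW W a ha a' ha' h
      have hres := ih (restrW (Wc W) w) (A \ W) o b (rW W) hcard (hrW W) hcomp
      rw [hWc, restr_real_fail w W (A \ W) hoW b] at hres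
      refine hres.trans (le_of_eq ?_)
      refine Finset.sum_congr rfl fun a ha => ?_
      rw [restr_real_firstPat w W _ hoW a, restr_real_openConn w W (Finset.mem_sdiff.1 ha).2 b]
    have hpeel := peel_bound w A o b d β hβ
    have hsplit : ∑ W ∈ Finset.univ.filter (fun W : Finset (Fin n) => o ∉ W ∧ b ∉ W), μ.real (clusterIs d W) * (1 - β W) =
        μ.real ((openConn d o)ᶜ ∩ (openConn d b)ᶜ : Set (BondConfig (Fin n)))
          - ∑ W ∈ Finset.univ.filter (fun W : Finset (Fin n) => o ∉ W ∧ b ∉ W), μ.real (clusterIs d W) * β W := by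
      rw [← sum_clusterIs_filter_eq w o b d, ← Finset.sum_sub_distrib]
      refine Finset.sum_congr rfl fun W _ => ?_
      ring
    have hdb : 1 - μ.real (openConn d b) =
        μ.real (openConn d o ∩ (openConn d b)ᶜ : Set (BondConfig (Fin n))) + μ.real ((openConn d o)ᶜ ∩ (openConn d b)ᶜ : Set (BondConfig (Fin n))) := by
      rw [← probReal_compl_eq_one_sub (hmeas _), ← measureReal_union (μ := μ) _ (hmeas _)]
      · congr 1
        ext ω
        simp only [mem_compl_iff, mem_union, mem_inter_iff]
        tauto
      · exact Set.disjoint_left.2 fun ω h1 h2 => h2.1 h1.1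
    rw [hsplit] at hpeel
    have hkey : μ.real ((⋃ a ∈ A, openConn o a) ∩ (openConn o b)ᶜ) ≤
        μ.real (openConn d o ∩ (openConn d b)ᶜ : Set (BondConfig (Fin n)))
          + μ.real (openConn d b ∩ (openConn d o)ᶜ ∩ (⋃ a ∈ A.erase d, openConn o a))
          + ∑ W ∈ Finset.univ.filter (fun W : Finset (Fin n) => o ∉ W ∧ b ∉ W), μ.real (clusterIs d W) * β W := by
      linarith
    exact hkey.trans hker

/-- **(LOC-peel) ⇒ `AdditiveGluing`.**  The AG-loc peeling kernel (see the module doc-string and `agloc_firstRank_of_locPeel`) closes the crux: it gives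
(AG-loc) for every relay set, and (AG-loc) implies `AdditiveGluing` by the landed `AGloc.additiveGluing_of_agloc_firstRank`.
[cite: KozmaNitzan2024, Conj. 1 (p. 3), §3.2 p. 12] -/
theorem additiveGluing_of_locPeel
    (hL : ∀ (n : ℕ) (w : Sym2 (Fin n) → unitInterval) (A : Finset (Fin n)) (o b : Fin n) (r : Fin n → ℕ),
      o ∉ A → b ∉ A → o ≠ b → 3 ≤ A.card → Set.InjOn r ↑A →
      (∀ a ∈ A, ∀ a' ∈ A, r a < r a' → (prodBernoulli w).real (openConn a b) ≤ (prodBernoulli w).real (openConn a' b)) →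
      ∃ d ∈ A, ∃ rW : Finset (Fin n) → (Fin n → ℕ),
        (∀ W : Finset (Fin n), Set.InjOn (rW W) ↑(A \ W)) ∧
        (∀ W : Finset (Fin n), ∀ a ∈ A \ W, ∀ a' ∈ A \ W, rW W a < rW W a' →
          (prodBernoulli w).real (openConnIn ((↑W : Set (Fin n))ᶜ) a b) ≤ (prodBernoulli w).real (openConnIn ((↑W : Set (Fin n))ᶜ) a' b)) ∧
        (prodBernoulli w).real (openConn d o ∩ (openConn d b)ᶜ : Set (BondConfig (Fin n)))
          + (prodBernoulli w).real (openConn d b ∩ (openConn d o)ᶜ ∩ (⋃ a ∈ A.erase d, openConn o a))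
          + ∑ W ∈ Finset.univ.filter (fun W : Finset (Fin n) => o ∉ W ∧ b ∉ W),
              (prodBernoulli w).real (clusterIs d W) *
                ∑ a ∈ A \ W, (prodBernoulli w).real
                    (openConnIn ((↑W : Set (Fin n))ᶜ) o a ∩
                      ⋂ a' ∈ (A \ W).filter (fun a' => rW W a' < rW W a), (openConnIn ((↑W : Set (Fin n))ᶜ) o a')ᶜ) *
                  (1 - (prodBernoulli w).real (openConnIn ((↑W : Set (Fin n))ᶜ) a b))
        ≤ ∑ a ∈ A, (prodBernoulli w).real
              (openConn o a ∩ ⋂ a' ∈ A.filter (fun a' => r a' < r a), (openConn o a')ᶜ : Set (BondConfig (Fin n))) *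
            (1 - (prodBernoulli w).real (openConn a b))) :
    Summit.CriticalPhenomena.PercolationContinuityZ3.Theses.PercNearOneGluing.AdditiveGluing :=
  AGloc.additiveGluing_of_agloc_firstRank fun n w A o b r hr hc =>
    agloc_firstRank_of_locPeel hL n A.card w A o b r le_rfl hr hc

end ClusterPeelLoc

end

end Summit.CriticalPhenomena.PercolationContinuityZ3.Theorems
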